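import Summits.QuantumFields.YangMills.Theorems.BalabanLadderNTClassicalShadowReflectionCentred
import Summits.QuantumFields.YangMills.Theorems.BalabanLadderNTBoundaryLawSymmetry
import HarnessLib

/-!
# Crux `NT` (stmt-QuantumFields-19353), stub `stub_refpkgT : RefPkgT`: THE CLASSICAL SHADOW, X — reflection of ANY axis: the
# orbit-test symmetry (S) for the axis-`k` reflection of a `k`-centred cube, by conjugating the time reflection with a coordinate swap

Helper file (`--supports stmt-QuantumFields-19353`) of the fleet lead prover of crux `NT` (unit `ym-spine-19353-p1`, GEN 14); sequel
of `…ClassicalShadowReflection[Centred]` (p604593, p604990) and `BoundaryLawSymmetry` (`kerE_perm`).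

The reflection of axis `k` acts on configurations by `R_k := σ_k ∘ Θ ∘ σ_k` with `σ_k` the relabelling along the coordinate swap `0 ↔ k`
(`relabelConfig (edgePerm (Equiv.swap 0 k))`) and `Θ = cfgReflect` the time reflection.  For the cube of radius `R` around a site `x` with
`x k = 0` (centred on the hyperplane `x_k = 0`) and an exterior fixed by `R_k`:

* `relabelConfig_swap_swap` (the swap relabelling is an involution), `sitePerm_swap_sub_const`;
* **`kerE_axisReflect_symm_centred`** — `kerE^η_β(F ∘ R_k) = kerE^η_β(F)` for measurable `F` (`kerE_perm` to move to the swapped cube, which is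
  time-centred since `(σ_k x) 0 = x k = 0`, `kerE_cfgReflect_symm_centred` there, `kerE_perm` back).

So hypothesis (S) of `…ClassicalShadowOrbit` is available for the full hyperoctahedral stabiliser of a cube centred at a lattice site
(permutations: `kerE_perm_symm_fun`; reflections: this file; up to gauge: `kerE_perm_gauge_symm_fun`).

HONEST FRAMING.  Bookkeeping over tree theorems; no floor, not AF, not NT, not the seam, not the gap; not Clay.
-/

set_option autoImplicit false

noncomputable section

open MeasureTheory Filter Topology
open Literature.MathematicalPhysics.QuantumFieldTheory Literature.MathematicalPhysics.QuantumLattice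
open Literature.Probability.LatticeModels
open Summit.QuantumFields.YangMills.Cruxes.OSLegsFromFemtoAndGap.DlrCollarTransfer

namespace Summit.QuantumFields.YangMills.Cruxes.NT.ClassicalShadow

section Swap

variable {G : Type} [MeasurableSpace G]

/-- The swap relabelling is an involution on configurations. [folklore] -/
theorem relabelConfig_swap_swap (i j : Fin 4) (U : LGConfig 4 G) :
    relabelConfig (edgePerm (Equiv.swap i j)) (relabelConfig (edgePerm (Equiv.swap i j)) U) = U := by
  have hs : ∀ y : Fin 4 → ℤ, sitePerm (Equiv.swap i j) (sitePerm (Equiv.swap i j) y) = y := fun y => by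
    funext k
    simp only [sitePerm_apply, Equiv.symm_swap, Equiv.swap_apply_self]
  funext e
  obtain ⟨y, m⟩ := e
  simp only [relabelConfig_apply, edgePerm_symm_apply, Equiv.symm_swap, Equiv.swap_apply_self, hs]

/-- A coordinate permutation commutes with subtracting a constant vector: `σ·(x − R) = σ·x − R`. [folklore] -/
theorem sitePerm_sub_const (σ : Equiv.Perm (Fin 4)) (x : Fin 4 → ℤ) (R : ℤ) :
    sitePerm σ (fun j => x j - R) = fun j => sitePerm σ x j - R := by
  funext j
  simp only [sitePerm_apply]

end Swap

section Axis

variable {G : Type} [Group G] [TopologicalSpace G] [IsTopologicalGroup G] [CompactSpace G]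
  [MeasurableSpace G] [BorelSpace G] (r : LatticeRep G)

/-- **(S) for the reflection of axis `k`** on the cube of radius `R` around a site `x` with `x k = 0`: if the exterior is fixed by
`R_k = σ_k ∘ Θ ∘ σ_k` then `kerE^η_β(F ∘ R_k) = kerE^η_β(F)` for every measurable `F`. [folklore] -/
theorem kerE_axisReflect_symm_centred (β : ℝ) (k : Fin 4) {x : Fin 4 → ℤ} (hx : x k = 0) (R : ℕ) {η : LGConfig 4 G}
    (hη : relabelConfig (edgePerm (Equiv.swap 0 k)) (cfgReflect (relabelConfig (edgePerm (Equiv.swap 0 k)) η)) = η)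
    {F : LGConfig 4 G → ℝ} (hF : Measurable F) :
    kerE G r β (fun j => x j - R) (2 * R + 1) η
        (F ∘ relabelConfig (edgePerm (Equiv.swap 0 k)) ∘ cfgReflect ∘ relabelConfig (edgePerm (Equiv.swap 0 k))) =
      kerE G r β (fun j => x j - R) (2 * R + 1) η F := by
  set σ : Equiv.Perm (Fin 4) := Equiv.swap 0 k with hσ
  -- the swapped cube is time-centred, and the swapped exterior is `Θ`-invariant
  have hx' : sitePerm σ x 0 = 0 := by rw [sitePerm_apply, hσ, Equiv.symm_swap, Equiv.swap_apply_left]; exact hx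
  have hc : sitePerm σ (fun j => x j - (R : ℤ)) = fun j => sitePerm σ x j - R := sitePerm_sub_const σ x R
  have hη' : cfgReflect (relabelConfig (edgePerm σ) η) = relabelConfig (edgePerm σ) η := by
    have h := congrArg (relabelConfig (edgePerm σ)) hη
    rw [relabelConfig_swap_swap] at h
    exact h
  -- move to the swapped cube (`kerE_perm` backwards), reflect there, move back
  have step1 := Summit.QuantumFields.YangMills.Cruxes.NT.BoundaryLaw.kerE_perm G r σ β (fun j => x j - (R : ℤ)) (2 * R + 1) η
    (F ∘ relabelConfig (edgePerm σ) ∘ cfgReflect)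
  have step2 := Summit.QuantumFields.YangMills.Cruxes.NT.BoundaryLaw.kerE_perm G r σ β (fun j => x j - (R : ℤ)) (2 * R + 1) η
    (F ∘ relabelConfig (edgePerm σ))
  have hFσ : Measurable (F ∘ relabelConfig (edgePerm σ)) := hF.comp (relabelConfig (edgePerm σ)).measurable
  have step3 : kerE G r β (sitePerm σ fun j => x j - (R : ℤ)) (2 * R + 1) (relabelConfig (edgePerm σ) η)
      ((F ∘ relabelConfig (edgePerm σ)) ∘ cfgReflect) =
      kerE G r β (sitePerm σ fun j => x j - (R : ℤ)) (2 * R + 1) (relabelConfig (edgePerm σ) η) (F ∘ relabelConfig (edgePerm σ)) := by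
    rw [hc]
    exact kerE_cfgReflect_symm_centred r β hx' R hη' hFσ
  have e2 : (F ∘ relabelConfig (edgePerm σ)) ∘ relabelConfig (edgePerm σ) = F := by
    funext U
    simp only [Function.comp_apply, hσ, relabelConfig_swap_swap]
  rw [e2] at step2
  calc kerE G r β (fun j => x j - R) (2 * R + 1) η (F ∘ relabelConfig (edgePerm σ) ∘ cfgReflect ∘ relabelConfig (edgePerm σ))
      = kerE G r β (sitePerm σ fun j => x j - (R : ℤ)) (2 * R + 1) (relabelConfig (edgePerm σ) η)
          ((F ∘ relabelConfig (edgePerm σ)) ∘ cfgReflect) := step1.symm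
    _ = kerE G r β (sitePerm σ fun j => x j - (R : ℤ)) (2 * R + 1) (relabelConfig (edgePerm σ) η) (F ∘ relabelConfig (edgePerm σ)) := step3
    _ = kerE G r β (fun j => x j - R) (2 * R + 1) η F := step2

end Axis

end Summit.QuantumFields.YangMills.Cruxes.NT.ClassicalShadow

end
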